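import Summits.QuantumFields.YangMills.Theorems.IR.AfPincerUcTypChainDeepReduced
import Summits.QuantumFields.YangMills.Theorems.IR.Negative.ClauseIITypChainFalseOfGroundStateChains
import Summits.QuantumFields.YangMills.Theorems.IR.Negative.TypChainSuppliersAvoidFluxEdgeChainWire
import HarnessLib

/-!
# Crux `IR` (stmt-QuantumFields-19354), line `af-pincer-Uc-sharp` — the ground-state engine of disprove-1 GEN 11 READ ON THE CORE:
# what it takes to kill conjunct (ii) for the DEEP class `TypChainDeep` / `KernelPlaqSparseDeep`, and the deep wire

Negative-side bookkeeping for item `stmt-QuantumFields-19354` (`--supports … --as helper`; closes no stub; registry and slot of record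
«sharp merge I♯_SC» `Cruxes/IR/Lines/af_pincer_Uc_sharp.lean` sha16 `28967a1bf60ad397` UNTOUCHED; the item's verdict of record stays
NOT-REFUTED).  Author: seat `ym-19354-afpincer-s1` GEN 4 (the seat that typed the re-cut candidate «TypChainDeep», p555685 / p557005).

CONTEXT.  Refuter `ym-19354-disprove-1` GEN 11 answered the LEAD's W3 with the kernel Laplace engine and the FIXED-FRAME kills of
conjunct (ii) for the class of record `TypChain` from CHAINED GROUND STATES (`ClauseIITypChainFalseOfGroundStateChains`, p557336) and
the mesh-uniform `FluxEdgeChainWire` with the supplier calibration (`TypChainSuppliersAvoidFluxEdgeChainWire`, p557361); its reading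
for suppliers ends *"print `θ` above the forcing level, or re-cut the class («TypChainDeep» …)"*.  THIS FILE types exactly what that
engine asks of the DEEP class, so that the re-cut's test is a by-name target (cdisprove: «depth-`2` core NOT immune at the sharp mesh»).

## What is PROVED here (no `sorry`; axioms ⊆ {propext, Classical.choice, Quot.sound})
* §1 part 1/2's chain detector for ANY finite plaquette family `Pl` (`chainSupportsAmong`, `chainFreeAmong`: continuous, `[0, 1]`-valued).
* §2 AT A FIXED FRAME, every depth `D`: `GroundStatesChainedDeep ρ θ m w ℓ₀ D c ζ` (every ground state of the cell's interior energy
  at `ζ` carries a `(θ + m)`-bad chain of extent `≥ ℓ₀` among the DEEP plaquettes `deepPlaqs w D c`) ⇒ `γ^β_{cell}(ζ')(TypChainDeep … D c)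
  ≤ s` near `ζ` for `β ≥ β₀` (`kernel_typChainDeep_le_of_groundStatesChainedDeep[_at]`) ⇒ with a deep-guard-clean `ζ`,
  **`¬ ClauseIIukp ρ β w δ (TypChainDeep ρ θ w ℓ₀ D)`**, `0 ≤ δ < 1`, all large `β` (`not_clauseIIukp_typChainDeep_of_groundStatesChainedDeep`);
  part 1/2's `GroundStatesForce … p ζ` for a DEEP `p ∈ deepPlaqs w D c` ⇒ **`¬ KernelPlaqSparseDeep ρ β w θ ℓ₀ D q`**, `0 ≤ q < 1`, all
  large `β` (`not_kernelPlaqSparseDeep_of_groundStatesForce`).  THE PRICE OF THE RE-CUT FOR THE REFUTER, typed: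
  `GroundStatesChainedDeep … D ⇒ GroundStatesChained` (`groundStatesChained_of_deep`; antitone in `D`; `D = 0` ⇔ part 1/2's hypothesis),
  and the guard of record ⇒ the deep guard (`deepGuard_of_guard`): every exterior killing the deep class through this engine ALSO kills
  the class of record, never conversely — the engine needs chained∕forced ground states IN THE CORE, for `D = 2` the opposite of what
  both cooling probes report (forcing on EDGES∕CORNERS, depth `≥ 2` at `≤ 0.03` of the exterior level: FORCING-NUMERICS-g3 rev 2,
  FINDING-flux-adversary #56, TYPCHAINDEEP-S1-g3 rev 3); the edge-chain hypothesis part 1/2 types does NOT feed the deep kill.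
* §3 the DEEP WIRE `DeepFluxChainWire ρ θ ℓ₀ D` (part 2/2's wire with guard AND event read in the deep sense; `D = 0` ⇔
  `FluxEdgeChainWire`) ⇒ at every mesh some frame violates clause (ii) for `TypChainDeep … D`, every `δ ≤ 1/2`
  (`exists_frame_not_clauseIIukp_typChainDeep_of_wire`); its fixed-frame instances from deep-chained ground states
  (`mass_compl_typChainDeep_gt_half_of_groundStatesChainedDeep`); SUPPLIER CALIBRATION by name: every witness of `TypChainDeepSharpSC` ∕
  `TypChainDeepReducedAtSC` (p557005) prints `(θ, ℓ₀, D)` ∕ `(θ, κ, C, D)` OUTSIDE the deep wire (`typChainDeep{SharpSC,ReducedAtSC}_avoids_deepWire`).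

## What is NOT proved, and the honest reading
`GroundStatesChainedDeep`, `GroundStatesForce` at a deep plaquette and `DeepFluxChainWire` are HYPOTHESES (zero-temperature ∕ thermal),
asserted for no `(G, ρ, θ, D)`; for `D = 2` the numerics speak against them.  Fixed mesh only in §2 (`β₀` from compactness, no rate).
The deep guard is WEAKER than the guard of record (neighbours may carry long bad chains in their boundary layers — the dense-insult
exteriors of TYPCHAINDEEP-S1-g3's located remark ARE admitted): the one place where the deep class is more exposed than `TypChain`; the
wire of §3 carries that weak guard on purpose.  Nothing here refutes `TypChainDeepSharpSC`, `OnsetSharpUKPcSC` or `IR`; nothing of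
weak-coupling mixing, asymptotic freedom or a mass gap; not infinite volume, not Clay.
-/

set_option autoImplicit false

noncomputable section

open MeasureTheory Filter Topology
open Literature.MathematicalPhysics.QuantumFieldTheory hiding ZdEdge
open Literature.MathematicalPhysics.QuantumLattice
open Literature.Probability.LatticeModels
open Summit.QuantumFields.YangMills.Cruxes.IR.Tempered (cellEdges regionEdges)
open Summit.QuantumFields.YangMills.Theorems.OddTorusChessboard (cellPlaqs plaqAction plaqAction_congr measurable_plaqAction)

namespace Summit.QuantumFields.YangMills.Cruxes.IR.AfPincerUc.SharpLanes.GroundStateForcingDeep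

open Summit.QuantumFields.YangMills.Cruxes.IR.AfPincerUc
open Summit.QuantumFields.YangMills.Cruxes.IR.AfPincerUc.SharpLanes
open Summit.QuantumFields.YangMills.Cruxes.IR.AfPincerUc.SharpLanes.GroundStateForcing
open Summit.QuantumFields.YangMills.Cruxes.IR.AfPincerUc.SharpLanes.FluxEdgeChain (FluxEdgeChainWire)
open Summit.QuantumFields.YangMills.Cruxes.OSLegsFromFemtoAndGap.DlrCollarTransfer (LowerBounds)

/-! ## §1 The chain detector over ANY finite plaquette family -/
section Detector

variable {G : Type} [Group G] {N : ℕ} (ρ : G →* Matrix (Fin N) (Fin N) ℂ)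

open Classical in
/-- The possible SUPPORTS of a long bad chain among the finite plaquette family `Pl`: the sets `R ⊆ Pl` that carry a chain shape
(steps `≤ 2` in `ℓ∞`, end-to-end extent `≥ ℓ₀`); `GroundStateForcing.chainSupports w c` is the instance `Pl = cellPlaqs w c`. -/
def chainSupportsAmong (Pl : Finset (ZdPlaquette 4)) (ℓ₀ : ℕ) : Finset (Finset (ZdPlaquette 4)) :=
  Pl.powerset.filter fun R => ∃ (k : ℕ) (ch : Fin (k + 1) → ZdPlaquette 4), (∀ i, ch i ∈ R) ∧
    (∀ i : Fin k, supNormZ4 ((ch i.castSucc).1 - (ch i.succ).1) ≤ 2) ∧ ℓ₀ ≤ supNormZ4 ((ch 0).1 - (ch (Fin.last k)).1)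

/-- A `θ`-bad chain of extent `≥ ℓ` among the finite family `Pl` EXISTS iff some chain support among `Pl` is entirely `θ`-bad. -/
theorem hasBadChainAmong_iff_exists_supportAmong (θ : ℝ) (Pl : Finset (ZdPlaquette 4)) (ℓ : ℕ) (U : LGConfig 4 G) :
    HasBadChainAmong ρ θ (↑Pl : Set (ZdPlaquette 4)) ℓ U ↔
      ∃ R ∈ chainSupportsAmong Pl ℓ, ∀ p ∈ R, θ ≤ plaqAction ρ p U := by
  classical
  constructor
  · rintro ⟨k, ch, hin, hbad, hstep, hext⟩
    refine ⟨Finset.univ.image ch, ?_, ?_⟩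
    · refine Finset.mem_filter.2 ⟨Finset.mem_powerset.2 ?_, k, ch, fun i => Finset.mem_image_of_mem ch (Finset.mem_univ i),
        hstep, hext⟩
      intro p hp
      obtain ⟨i, -, rfl⟩ := Finset.mem_image.1 hp
      exact Finset.mem_coe.1 (hin i)
    · intro p hp
      obtain ⟨i, -, rfl⟩ := Finset.mem_image.1 hp
      exact hbad i
  · rintro ⟨R, hR, hall⟩
    obtain ⟨hRsub, k, ch, hchR, hstep, hext⟩ := Finset.mem_filter.1 hR
    exact ⟨k, ch, fun i => Finset.mem_coe.2 (Finset.mem_powerset.1 hRsub (hchR i)), fun i => hall _ (hchR i), hstep, hext⟩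

/-- **The chain detector over `Pl`**: `∏_{R} (1 − ∏_{p ∈ R} softBad_{θ,m}(p, ·))` over the chain supports `R` among `Pl` — continuous,
`[0, 1]`-valued, `= 1` on `{U | no θ-bad chain of extent ≥ ℓ₀ among Pl}`, `= 0` on configurations carrying a `(θ + m)`-bad such chain. -/
def chainFreeAmong (θ m : ℝ) (Pl : Finset (ZdPlaquette 4)) (ℓ₀ : ℕ) (U : LGConfig 4 G) : ℝ :=
  ∏ R ∈ chainSupportsAmong Pl ℓ₀, (1 - ∏ p ∈ R, softBad ρ θ m p U)

/-- The detector is nonnegative. -/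
theorem chainFreeAmong_nonneg (θ m : ℝ) (Pl : Finset (ZdPlaquette 4)) (ℓ₀ : ℕ) (U : LGConfig 4 G) :
    0 ≤ chainFreeAmong ρ θ m Pl ℓ₀ U :=
  Finset.prod_nonneg fun R _ => by linarith [(prod_softBad_mem_Icc ρ θ m R U).2]

/-- Off `θ`-chains the detector reads `1`: every chain support among `Pl` contains a plaquette of action `< θ`. -/
theorem chainFreeAmong_eq_one_of_not_hasBadChainAmong {θ m : ℝ} (hm : 0 < m) {Pl : Finset (ZdPlaquette 4)} {ℓ₀ : ℕ}
    {U : LGConfig 4 G} (hU : ¬ HasBadChainAmong ρ θ (↑Pl : Set (ZdPlaquette 4)) ℓ₀ U) : chainFreeAmong ρ θ m Pl ℓ₀ U = 1 := by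
  refine Finset.prod_eq_one fun R hR => ?_
  have hex : ∃ p ∈ R, plaqAction ρ p U < θ := by
    by_contra h
    push Not at h
    exact hU ((hasBadChainAmong_iff_exists_supportAmong ρ θ Pl ℓ₀ U).2 ⟨R, hR, h⟩)
  obtain ⟨p, hp, hlt⟩ := hex
  rw [Finset.prod_eq_zero hp (softBad_eq_zero_of_lt ρ hm hlt), sub_zero]

/-- On a configuration carrying a `(θ + m)`-bad long chain among `Pl` the detector reads `0`. -/
theorem chainFreeAmong_eq_zero_of_chain {θ m : ℝ} (hm : 0 < m) {Pl : Finset (ZdPlaquette 4)} {ℓ₀ : ℕ} {U : LGConfig 4 G}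
    (hU : HasBadChainAmong ρ (θ + m) (↑Pl : Set (ZdPlaquette 4)) ℓ₀ U) : chainFreeAmong ρ θ m Pl ℓ₀ U = 0 := by
  obtain ⟨R, hR, hall⟩ := (hasBadChainAmong_iff_exists_supportAmong ρ (θ + m) Pl ℓ₀ U).1 hU
  refine Finset.prod_eq_zero hR ?_
  rw [Finset.prod_eq_one fun p hp => softBad_eq_one_of_le ρ hm (hall p hp), sub_self]

variable [TopologicalSpace G] [IsTopologicalGroup G]

/-- Continuity of the detector (continuous `ρ`). -/
theorem continuous_chainFreeAmong (hρ : Continuous ρ) (θ m : ℝ) (Pl : Finset (ZdPlaquette 4)) (ℓ₀ : ℕ) :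
    Continuous (chainFreeAmong (G := G) ρ θ m Pl ℓ₀) := by
  unfold chainFreeAmong
  exact continuous_finsetProd _ fun R _ =>
    continuous_const.sub (continuous_finsetProd _ fun p _ => continuous_softBad ρ hρ θ m p)

end Detector

/-! ## §2 The fixed-frame kills READ ON THE CORE: what the engine needs against `TypChainDeep` ∕ `KernelPlaqSparseDeep` -/
section Guard

variable {G : Type} [Group G] {N : ℕ} (ρ : G →* Matrix (Fin N) (Fin N) ℂ)

omit [Group G] in
/-- The one-cell guard `F = F' = {c}` of `ClauseIIukp` ∕ `KernelPlaqSparse{,Deep}` from a guard on the `3⁴ − 1` cells around `c`. -/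
theorem guard_singleton {Typ : (Fin 4 → ℤ) → Set (LGConfig 4 G)} {c : Fin 4 → ℤ} {ζ : LGConfig 4 G}
    (hguard : ∀ c' : Fin 4 → ℤ, c' ≠ c → (∀ i, |c' i - c i| ≤ 1) → ζ ∈ Typ c') :
    ∀ c₁ ∈ ({c} : Finset (Fin 4 → ℤ)), ∀ c' : Fin 4 → ℤ, (∀ i, |c' i - c₁ i| ≤ 1) →
      c' ∈ ({c} : Finset (Fin 4 → ℤ)) ∨ ζ ∈ Typ c' := by
  intro c₁ hc₁ c' hc'
  rw [Finset.mem_singleton.1 hc₁] at hc'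
  by_cases h' : c' = c
  · exact Or.inl (Finset.mem_singleton.2 h')
  · exact Or.inr (hguard c' h' hc')

/-- An exterior with NO `θ`-bad plaquette among a cell's DEEP plaquettes is deep-typical there (its boundary layers are not read). -/
theorem mem_typChainDeep_of_forall_lt {θ : ℝ} {w : Fin 4 → ℤ → ℤ} {ℓ₀ D : ℕ} {c : Fin 4 → ℤ} {ζ : LGConfig 4 G}
    (h : ∀ p ∈ deepPlaqs w D c, plaqAction ρ p ζ < θ) : ζ ∈ TypChainDeep ρ θ w ℓ₀ D c := by
  rintro ⟨k, ch, hin, hbad, -, -⟩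
  exact absurd (hbad 0) (not_le.2 (h _ (Finset.mem_coe.1 (hin 0))))

/-- **The guard of record implies the deep guard (PROVED)** (`TypChain ⊆ TypChainDeep`).  The converse fails: the deep guard admits
neighbours with long bad chains in their boundary layers. -/
theorem deepGuard_of_guard {θ : ℝ} {w : Fin 4 → ℤ → ℤ} {ℓ₀ : ℕ} (D : ℕ) {c : Fin 4 → ℤ} {ζ : LGConfig 4 G}
    (hguard : ∀ c' : Fin 4 → ℤ, c' ≠ c → (∀ i, |c' i - c i| ≤ 1) → ζ ∈ TypChain ρ θ w ℓ₀ c') :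
    ∀ c' : Fin 4 → ℤ, c' ≠ c → (∀ i, |c' i - c i| ≤ 1) → ζ ∈ TypChainDeep ρ θ w ℓ₀ D c' :=
  fun c' hc' hcc => typChain_subset_typChainDeep θ w ℓ₀ D c' (hguard c' hc' hcc)

/-- **HYPOTHESIS «ground states are chained IN THE DEPTH-`D` CORE» (zero temperature, finite-dimensional; asserted for no datum).**
At exterior `ζ`, EVERY ground state of the interior energy of the cell `c` of the frame `w` (region `regionEdges w {c}`, all other
links frozen to `ζ`) carries a `(θ + m)`-bad chain of extent `≥ ℓ₀` among the DEEP plaquettes `deepPlaqs w D c` (`D = 0`: part 1/2's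
`GroundStatesChained`).  For `D = 2` both cooling probes of record report the opposite at every measured exterior family. -/
def GroundStatesChainedDeep (θ m : ℝ) (w : Fin 4 → ℤ → ℤ) (ℓ₀ D : ℕ) (c : Fin 4 → ℤ) (ζ : LGConfig 4 G) : Prop :=
  ∀ x : ↥(regionEdges w {c}) → G, IsGroundState ρ (regionEdges w {c}) ζ x →
    HasBadChainAmong ρ (θ + m) (↑(deepPlaqs w D c) : Set (ZdPlaquette 4)) ℓ₀ (glueWith (regionEdges w {c}) x ζ)

/-- **The deep hypothesis is the STRONGER one (PROVED):** ground states chained in the core are chained in the cell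
(`deepPlaqs w D c ⊆ cellPlaqs w c`).  So an exterior that kills `TypChainDeep … D` through this engine also kills the class of
record `TypChain` (part 1/2) — never conversely. -/
theorem groundStatesChained_of_deep {θ m : ℝ} {w : Fin 4 → ℤ → ℤ} {ℓ₀ D : ℕ} {c : Fin 4 → ℤ} {ζ : LGConfig 4 G}
    (h : GroundStatesChainedDeep ρ θ m w ℓ₀ D c ζ) : GroundStatesChained ρ θ m w ℓ₀ c ζ :=
  fun x hx => (h x hx).mono_set (Finset.coe_subset.2 (deepPlaqs_subset w D c))

/-- `GroundStatesChainedDeep` is antitone in the depth: chained in a deeper core ⇒ chained in a shallower one. -/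
theorem groundStatesChainedDeep_anti {θ m : ℝ} {w : Fin 4 → ℤ → ℤ} {ℓ₀ D D' : ℕ} (hDD' : D ≤ D') {c : Fin 4 → ℤ}
    {ζ : LGConfig 4 G} (h : GroundStatesChainedDeep ρ θ m w ℓ₀ D' c ζ) : GroundStatesChainedDeep ρ θ m w ℓ₀ D c ζ :=
  fun x hx => (h x hx).mono_set (Finset.coe_subset.2 (deepPlaqs_anti w hDD' c))

/-- Depth `0`: the deep hypothesis IS part 1/2's `GroundStatesChained`. -/
theorem groundStatesChainedDeep_zero_iff {θ m : ℝ} {w : Fin 4 → ℤ → ℤ} {ℓ₀ : ℕ} {c : Fin 4 → ℤ} {ζ : LGConfig 4 G} :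
    GroundStatesChainedDeep ρ θ m w ℓ₀ 0 c ζ ↔ GroundStatesChained ρ θ m w ℓ₀ c ζ := by
  simp only [GroundStatesChainedDeep, GroundStatesChained, deepPlaqs_zero]

end Guard

section FixedFrame

variable {G : Type} [Group G] [TopologicalSpace G] [IsTopologicalGroup G] [CompactSpace G]
  [MeasurableSpace G] [BorelSpace G] [SecondCountableTopology G] {N : ℕ} (ρ : G →* Matrix (Fin N) (Fin N) ℂ)

/-- **Deep-chained ground states empty the deep class (PROVED; closed family of exteriors).**  If the ground states are chained in
the depth-`D` core at every exterior of the closed family `K`, then for every `s > 0`: `γ^β_{cell c}(ζ)(TypChainDeep ρ θ w ℓ₀ D c) ≤ s`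
for all `β ≥ β₀` and all `ζ` in an OPEN `O ⊇ K` (part 1/2's `kernel_measure_le_of_groundStates`, detector of §1 over `deepPlaqs w D c`). -/
theorem kernel_typChainDeep_le_of_groundStatesChainedDeep (hρ : Continuous ρ) {θ m : ℝ} (hm : 0 < m) (w : Fin 4 → ℤ → ℤ)
    (ℓ₀ D : ℕ) (c : Fin 4 → ℤ) {K : Set (LGConfig 4 G)} (hK : IsClosed K)
    (hGS : ∀ ζ ∈ K, GroundStatesChainedDeep ρ θ m w ℓ₀ D c ζ) {s : ℝ} (hs : 0 < s) :
    ∃ O : Set (LGConfig 4 G), IsOpen O ∧ K ⊆ O ∧ ∃ β₀ : ℝ, ∀ β : ℝ, β₀ ≤ β → ∀ ζ ∈ O,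
      (ymSpecification ρ β (regionEdges w {c}) ζ) (TypChainDeep ρ θ w ℓ₀ D c) ≤ ENNReal.ofReal s :=
  kernel_measure_le_of_groundStates ρ hρ _ hK (measurableSet_typChainDeep ρ hρ θ w ℓ₀ D c)
    (continuous_chainFreeAmong ρ hρ θ m (deepPlaqs w D c) ℓ₀)
    (fun _ hU => (chainFreeAmong_eq_one_of_not_hasBadChainAmong ρ hm hU).ge) (chainFreeAmong_nonneg ρ θ m _ ℓ₀)
    (fun ζ hζ x hx => (chainFreeAmong_eq_zero_of_chain ρ hm (hGS ζ hζ x hx)).le) hs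

/-- **Deep-chained ground states empty the deep class (PROVED; one exterior, no separation hypothesis on `G`)**: the bound holds on
an open neighbourhood of the given exterior `ζ` (closed family `closure {ζ}`, thermodynamically identical to `ζ`). -/
theorem kernel_typChainDeep_le_of_groundStatesChainedDeep_at (hρ : Continuous ρ) {θ m : ℝ} (hm : 0 < m) (w : Fin 4 → ℤ → ℤ)
    (ℓ₀ D : ℕ) (c : Fin 4 → ℤ) {ζ : LGConfig 4 G} (hGS : GroundStatesChainedDeep ρ θ m w ℓ₀ D c ζ) {s : ℝ} (hs : 0 < s) :
    ∃ O : Set (LGConfig 4 G), IsOpen O ∧ ζ ∈ O ∧ ∃ β₀ : ℝ, ∀ β : ℝ, β₀ ≤ β → ∀ ζ' ∈ O,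
      (ymSpecification ρ β (regionEdges w {c}) ζ') (TypChainDeep ρ θ w ℓ₀ D c) ≤ ENNReal.ofReal s := by
  have hK : ∀ y ∈ closure ({ζ} : Set (LGConfig 4 G)), GroundStatesChainedDeep ρ θ m w ℓ₀ D c y := by
    intro y hy x hx
    have hx' : IsGroundState ρ (regionEdges w {c}) ζ x := (isGroundState_iff_of_mem_closure_singleton ρ hρ hy _ x).1 hx
    refine (hGS x hx').congr fun q _ => ?_
    exact (eq_of_mem_closure_singleton hy _
      (continuous_const.sub (continuous_plaquetteObs ρ hρ q.1 q.2.1.1 q.2.1.2) : Continuous (plaqAction (G := G) ρ q)) x).symm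
  obtain ⟨O, hO, hKO, β₀, h⟩ := kernel_typChainDeep_le_of_groundStatesChainedDeep ρ hρ hm w ℓ₀ D c isClosed_closure hK hs
  exact ⟨O, hO, hKO (subset_closure (Set.mem_singleton ζ)), β₀, h⟩

/-- **¬(ii) FOR THE DEEP CLASS AT A FIXED FRAME from deep-chained ground states under a deep-guard-clean exterior (PROVED).**  If `ζ` is
deep-typical on the `3⁴ − 1` cells around `c` (met by the guard of record, `deepGuard_of_guard`, e.g. by any exterior without `θ`-bad
plaquettes there) and the ground states of the cell `c` at `ζ` are chained IN THE CORE, then for every budget `0 ≤ δ < 1` clause (ii) in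
UKP form FAILS for `TypChainDeep ρ θ w ℓ₀ D` on `w` at all large `β` (`F = F' = {c}`, exterior `ζ`; FIXED MESH: `β₀` from compactness). -/
theorem not_clauseIIukp_typChainDeep_of_groundStatesChainedDeep (hρ : Continuous ρ) {θ m : ℝ} (hm : 0 < m)
    (w : Fin 4 → ℤ → ℤ) (ℓ₀ D : ℕ) (c : Fin 4 → ℤ) {ζ : LGConfig 4 G}
    (hguard : ∀ c' : Fin 4 → ℤ, c' ≠ c → (∀ i, |c' i - c i| ≤ 1) → ζ ∈ TypChainDeep ρ θ w ℓ₀ D c')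
    (hGS : GroundStatesChainedDeep ρ θ m w ℓ₀ D c ζ) {δ : ℝ} (hδ0 : 0 ≤ δ) (hδ : δ < 1) :
    ∃ β₀ : ℝ, ∀ β : ℝ, β₀ ≤ β → ¬ ClauseIIukp ρ β w δ (TypChainDeep ρ θ w ℓ₀ D) := by
  obtain ⟨O, -, hζO, β₀, h⟩ :=
    kernel_typChainDeep_le_of_groundStatesChainedDeep_at ρ hρ hm w ℓ₀ D c hGS (s := (1 - δ) / 2) (by linarith)
  refine ⟨β₀, fun β hβ hII => ?_⟩
  haveI := isProbabilityMeasure_ymSpecification ρ hρ β (regionEdges w {c}) ζ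
  have hle := hII {c} {c} (Finset.Subset.refl _) (Finset.singleton_nonempty c) ζ (guard_singleton hguard)
  have hset : {σ : LGConfig 4 G | ∀ c₁ ∈ ({c} : Finset (Fin 4 → ℤ)), σ ∉ TypChainDeep ρ θ w ℓ₀ D c₁} =
      (TypChainDeep ρ θ w ℓ₀ D c)ᶜ := by
    ext σ; simp
  rw [hset, Finset.card_singleton, pow_one, prob_compl_eq_one_sub (measurableSet_typChainDeep ρ hρ θ w ℓ₀ D c)] at hle
  have h1 : (1 : ENNReal) ≤ ENNReal.ofReal δ + ENNReal.ofReal ((1 - δ) / 2) :=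
    (tsub_le_iff_right.1 hle).trans (add_le_add le_rfl (h β hβ ζ hζO))
  rw [← ENNReal.ofReal_add hδ0 (by linarith), ← ENNReal.ofReal_one] at h1
  have h2 := (ENNReal.ofReal_le_ofReal_iff (by linarith)).1 h1
  linarith

/-- **¬(DEEP kernel plaquette sparseness) AT A FIXED FRAME from ONE forced DEEP plaquette (PROVED).**  If the ground states of the cell
`c` at the deep-guard-clean exterior `ζ` force the DEEP plaquette `p ∈ deepPlaqs w D c` to action `≥ θ + m` (part 1/2's
`GroundStatesForce`), then `KernelPlaqSparseDeep ρ β w θ ℓ₀ D q` FAILS for every base `0 ≤ q < 1` at all large `β` (`F = F' = {c}`,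
`X = {p}`).  A forced plaquette in a BOUNDARY LAYER (depth `< D`: every forced plaquette of the numerics) does not instantiate this. -/
theorem not_kernelPlaqSparseDeep_of_groundStatesForce (hρ : Continuous ρ) {θ m : ℝ} (hm : 0 < m) (w : Fin 4 → ℤ → ℤ)
    (ℓ₀ D : ℕ) (c : Fin 4 → ℤ) {p : ZdPlaquette 4} (hp : p ∈ deepPlaqs w D c) {ζ : LGConfig 4 G}
    (hguard : ∀ c' : Fin 4 → ℤ, c' ≠ c → (∀ i, |c' i - c i| ≤ 1) → ζ ∈ TypChainDeep ρ θ w ℓ₀ D c')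
    (hGS : GroundStatesForce ρ θ m w c p ζ) {q : ℝ} (hq0 : 0 ≤ q) (hq : q < 1) :
    ∃ β₀ : ℝ, ∀ β : ℝ, β₀ ≤ β → ¬ KernelPlaqSparseDeep ρ β w θ ℓ₀ D q := by
  obtain ⟨O, -, hζO, β₀, h⟩ := kernel_plaqClean_le_of_groundStatesForce_at ρ hρ hm w c p hGS (s := (1 - q) / 2) (by linarith)
  refine ⟨β₀, fun β hβ hK => ?_⟩
  haveI := isProbabilityMeasure_ymSpecification ρ hρ β (regionEdges w {c}) ζ
  have hle := hK {c} {c} (Finset.Subset.refl _) (Finset.singleton_nonempty c) ζ (guard_singleton hguard) {p}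
    (by rw [Finset.singleton_biUnion]; exact Finset.singleton_subset_iff.2 hp)
  have hset : {σ : LGConfig 4 G | ∀ p₁ ∈ ({p} : Finset (ZdPlaquette 4)), θ ≤ plaqAction ρ p₁ σ} =
      {σ : LGConfig 4 G | plaqAction ρ p σ < θ}ᶜ := by
    ext σ; simp [not_lt]
  rw [hset, Finset.card_singleton, pow_one,
    prob_compl_eq_one_sub (measurableSet_lt (measurable_plaqAction ρ hρ p) measurable_const)] at hle
  have h1 : (1 : ENNReal) ≤ ENNReal.ofReal q + ENNReal.ofReal ((1 - q) / 2) :=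
    (tsub_le_iff_right.1 hle).trans (add_le_add le_rfl (h β hβ ζ hζO))
  rw [← ENNReal.ofReal_add hq0 (by linarith), ← ENNReal.ofReal_one] at h1
  have h2 := (ENNReal.ofReal_le_ofReal_iff (by linarith)).1 h1
  linarith

/-- **Fixed-frame instances of the deep wire from deep-chained ground states (PROVED):** ground states of the cell `c` at `ζ` chained
in the core ⇒ kernel mass `> 1/2` on long DEEP chains for all large `β`, near `ζ` (the wire's per-frame conjunct; mesh-uniformity NOT addressed). -/
theorem mass_compl_typChainDeep_gt_half_of_groundStatesChainedDeep (hρ : Continuous ρ) {θ m : ℝ} (hm : 0 < m)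
    (w : Fin 4 → ℤ → ℤ) (ℓ₀ D : ℕ) (c : Fin 4 → ℤ) {ζ : LGConfig 4 G} (hGS : GroundStatesChainedDeep ρ θ m w ℓ₀ D c ζ) :
    ∃ O : Set (LGConfig 4 G), IsOpen O ∧ ζ ∈ O ∧ ∃ β₀ : ℝ, ∀ β : ℝ, β₀ ≤ β → ∀ ζ' ∈ O,
      ENNReal.ofReal (1 / 2) < (ymSpecification ρ β (regionEdges w {c}) ζ') (TypChainDeep ρ θ w ℓ₀ D c)ᶜ := by
  obtain ⟨O, hO, hζO, β₀, h⟩ :=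
    kernel_typChainDeep_le_of_groundStatesChainedDeep_at ρ hρ hm w ℓ₀ D c hGS (s := 1 / 4) (by norm_num)
  refine ⟨O, hO, hζO, β₀, fun β hβ ζ' hζ' => ?_⟩
  haveI := isProbabilityMeasure_ymSpecification ρ hρ β (regionEdges w {c}) ζ'
  rw [prob_compl_eq_one_sub (measurableSet_typChainDeep ρ hρ θ w ℓ₀ D c)]
  have h34 : ENNReal.ofReal (1 / 2) < 1 - ENNReal.ofReal (1 / 4) := by
    rw [← ENNReal.ofReal_one, ← ENNReal.ofReal_sub _ (by norm_num : (0 : ℝ) ≤ 1 / 4)]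
    exact (ENNReal.ofReal_lt_ofReal_iff (by norm_num)).2 (by norm_num)
  exact h34.trans_le (tsub_le_tsub_left (h β hβ ζ' hζ') _)

end FixedFrame

/-! ## §3 The DEEP wire (uniform in the mesh) and the calibration of the deep suppliers -/
section Wire

variable {G : Type} [Group G] [TopologicalSpace G] [IsTopologicalGroup G] [CompactSpace G]
  [MeasurableSpace G] [BorelSpace G]

/-- **The deep flux-chain wire at `(θ, ℓ₀, D)`** — part 2/2's `FluxEdgeChainWire` with the guard AND the event read in the deep sense:
from some `β₀` on, at EVERY mesh `b ≥ 1` some mesh-`b` frame `w` has a cell `c` and an exterior `ζ`, deep-typical on the `3⁴ − 1` cells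
around `c`, under which the cell's DLR kernel gives mass `> 1/2` to configurations carrying a `θ`-bad chain of extent `≥ ℓ₀` among the
DEEP plaquettes `deepPlaqs w D c` (`D = 0` ⇔ `FluxEdgeChainWire`).  A HYPOTHESIS, asserted for no datum; the weak (deep) guard is deliberate. -/
def DeepFluxChainWire {N : ℕ} (ρ : G →* Matrix (Fin N) (Fin N) ℂ) (θ : ℝ) (ℓ₀ D : ℕ) : Prop :=
  ∃ β₀ : ℝ, ∀ β : ℝ, β₀ ≤ β → ∀ b : ℕ, 1 ≤ b → ∃ w : Fin 4 → ℤ → ℤ, IsFrame b w ∧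
    ∃ (c : Fin 4 → ℤ) (ζ : LGConfig 4 G),
      (∀ c' : Fin 4 → ℤ, c' ≠ c → (∀ i, |c' i - c i| ≤ 1) → ζ ∈ TypChainDeep ρ θ w ℓ₀ D c') ∧
        ENNReal.ofReal (1 / 2) < (ymSpecification ρ β (regionEdges w {c}) ζ) (TypChainDeep ρ θ w ℓ₀ D c)ᶜ

variable {N : ℕ} (ρ : G →* Matrix (Fin N) (Fin N) ℂ)

/-- Depth `0`: the deep wire IS part 2/2's `FluxEdgeChainWire`. -/
theorem deepFluxChainWire_zero_iff (θ : ℝ) (ℓ₀ : ℕ) : DeepFluxChainWire ρ θ ℓ₀ 0 ↔ FluxEdgeChainWire ρ θ ℓ₀ := by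
  simp only [DeepFluxChainWire, FluxEdgeChainWire, typChainDeep_zero]

/-- **Kernel mass `> 1/2` on long DEEP chains under a deep-guard-clean exterior refutes clause (ii) for the deep class for every budget
`δ ≤ 1/2` (PROVED)** — the one-cell instance `F = F' = {c}`. -/
theorem not_clauseIIukp_typChainDeep_of_mass {β θ : ℝ} {w : Fin 4 → ℤ → ℤ} {ℓ₀ D : ℕ} {c : Fin 4 → ℤ} {ζ : LGConfig 4 G}
    (hguard : ∀ c' : Fin 4 → ℤ, c' ≠ c → (∀ i, |c' i - c i| ≤ 1) → ζ ∈ TypChainDeep ρ θ w ℓ₀ D c')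
    (hmass : ENNReal.ofReal (1 / 2) < (ymSpecification ρ β (regionEdges w {c}) ζ) (TypChainDeep ρ θ w ℓ₀ D c)ᶜ) {δ : ℝ}
    (hδ : δ ≤ 1 / 2) : ¬ ClauseIIukp ρ β w δ (TypChainDeep ρ θ w ℓ₀ D) := by
  intro hII
  have hle := hII {c} {c} (Finset.Subset.refl _) (Finset.singleton_nonempty c) ζ (guard_singleton hguard)
  have hset : {σ : LGConfig 4 G | ∀ c₁ ∈ ({c} : Finset (Fin 4 → ℤ)), σ ∉ TypChainDeep ρ θ w ℓ₀ D c₁} =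
      (TypChainDeep ρ θ w ℓ₀ D c)ᶜ := by
    ext σ; simp
  rw [hset, Finset.card_singleton, pow_one] at hle
  exact (lt_irrefl _) ((hle.trans (ENNReal.ofReal_le_ofReal hδ)).trans_lt hmass)

/-- **The deep wire kills the per-frame (ii)-demand for the deep class at EVERY mesh (PROVED)**, for every budget `δ ≤ 1/2`. -/
theorem exists_frame_not_clauseIIukp_typChainDeep_of_wire {θ : ℝ} {ℓ₀ D : ℕ} (hW : DeepFluxChainWire ρ θ ℓ₀ D) :
    ∃ β₀ : ℝ, ∀ β : ℝ, β₀ ≤ β → ∀ b : ℕ, 1 ≤ b → ∀ δ : ℝ, δ ≤ 1 / 2 →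
      ∃ w : Fin 4 → ℤ → ℤ, IsFrame b w ∧ ¬ ClauseIIukp ρ β w δ (TypChainDeep ρ θ w ℓ₀ D) := by
  obtain ⟨β₀, h⟩ := hW
  refine ⟨β₀, fun β hβ b hb δ hδ => ?_⟩
  obtain ⟨w, hw, c, ζ, hguard, hmass⟩ := h β hβ b hb
  exact ⟨w, hw, not_clauseIIukp_typChainDeep_of_mass ρ hguard hmass hδ⟩

end Wire

section Supplier

/-- **Every witness of `TypChainDeepSharpSC` avoids the deep wire (PROVED).**  At any SC datum with `LowerBounds`, a supplier of the deep
lane-A statement prints `(n, ε, θ, ℓ₀, D)` with `¬ DeepFluxChainWire r.ρ θ ℓ₀ D` (calibration of `(θ, D)`, not a refutation of the format). -/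
theorem typChainDeepSharpSC_avoids_deepWire (h : TypChainDeepSharpSC) (G : Type) [Group G] [TopologicalSpace G]
    [IsTopologicalGroup G] [CompactSpace G] (hG : IsCompactSimpleLieGroup G) (hsc : SimplyConnectedSpace G) :
    letI : MeasurableSpace G := borel G
    haveI : BorelSpace G := ⟨rfl⟩
    ∀ (r : LatticeRep G) (a : ℝ → ℝ), (∀ β, 0 < a β) → Tendsto a atTop (𝓝 0) → LowerBounds G r a →
      ∃ (n : ℕ) (ε : ℝ) (θ : ℝ) (ℓ₀ D : ℕ), ¬ DeepFluxChainWire r.ρ θ ℓ₀ D ∧ 1 ≤ n ∧ 0 ≤ ε ∧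
        ε * OnsetFormats.shellCount n ≤ 3 / 4 ∧
        ∀ δ : ℝ, 0 < δ → ∃ T β₂ : ℝ, ∀ β : ℝ, β₂ ≤ β → ∃ b : ℕ, 1 ≤ b ∧ a β * (b : ℝ) < T ∧
          ∀ w : Fin 4 → ℤ → ℤ, IsFrame b w →
            ClauseIAll r.ρ β w n ε (TypChainDeep r.ρ θ w ℓ₀ D) ∧ ClauseIIukp r.ρ β w δ (TypChainDeep r.ρ θ w ℓ₀ D) ∧
              ClauseIII r.ρ β w b δ (TypChainDeep r.ρ θ w ℓ₀ D) := by
  letI : MeasurableSpace G := borel G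
  haveI : BorelSpace G := ⟨rfl⟩
  intro r a ha hat hlb
  obtain ⟨n, ε, θ, ℓ₀, D, hn, hε, hM, hsup⟩ := h G hG hsc r a ha hat hlb
  refine ⟨n, ε, θ, ℓ₀, D, fun hW => ?_, hn, hε, hM, hsup⟩
  obtain ⟨β₀, hβ₀⟩ := exists_frame_not_clauseIIukp_typChainDeep_of_wire r.ρ hW
  obtain ⟨T, β₂, hβ₂⟩ := hsup (1 / 2) (by norm_num)
  obtain ⟨b, hb1, -, hframes⟩ := hβ₂ (max β₀ β₂) (le_max_right _ _)
  obtain ⟨w, hw, hnot⟩ := hβ₀ (max β₀ β₂) (le_max_left _ _) b hb1 (1 / 2) le_rfl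
  exact hnot (hframes w hw).2.1

/-- **Every witness of the REDUCED deep supplier statement `TypChainDeepReducedAtSC` avoids the deep wire at its served extent (PROVED):**
the printed `(θ, κ, C, D)` satisfy `¬ DeepFluxChainWire r.ρ θ (extentOf θ κ C) D` (via `clauses_typChainDeep_extentOf` at budget `1/2`). -/
theorem typChainDeepReducedAtSC_avoids_deepWire (h : TypChainDeepReducedAtSC) (G : Type) [Group G] [TopologicalSpace G]
    [IsTopologicalGroup G] [CompactSpace G] (hG : IsCompactSimpleLieGroup G) (hsc : SimplyConnectedSpace G) :
    letI : MeasurableSpace G := borel G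
    haveI : BorelSpace G := ⟨rfl⟩
    ∀ (r : LatticeRep G) (a : ℝ → ℝ), (∀ β, 0 < a β) → Tendsto a atTop (𝓝 0) → LowerBounds G r a →
      ∃ (n : ℕ) (ε θ κ C : ℝ) (D : ℕ), ¬ DeepFluxChainWire r.ρ θ (extentOf θ κ C) D ∧
        1 ≤ n ∧ 0 ≤ ε ∧ ε * OnsetFormats.shellCount n ≤ 3 / 4 ∧ 0 < θ ∧ 0 < κ ∧
        ∀ δ : ℝ, 0 < δ → ∃ T B β₂ : ℝ, ∀ β : ℝ, β₂ ≤ β →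
          ∃ b : ℕ, 1 ≤ b ∧ a β * (b : ℝ) < T ∧ (b : ℝ) ≤ B * Real.exp (C * β) ∧
            ∀ w : Fin 4 → ℤ → ℤ, IsFrame b w →
              ClauseIAll r.ρ β w n ε (TypChainDeep r.ρ θ w (extentOf θ κ C) D) ∧
                KernelPlaqSparseDeep r.ρ β w θ (extentOf θ κ C) D (Real.exp (-(κ * β))) := by
  letI : MeasurableSpace G := borel G
  haveI : BorelSpace G := ⟨rfl⟩
  intro r a ha hat hlb
  obtain ⟨n, ε, θ, κ, C, D, hn, hε, hM, hθ, hκ, hsup⟩ := h G hG hsc r a ha hat hlb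
  refine ⟨n, ε, θ, κ, C, D, fun hW => ?_, hn, hε, hM, hθ, hκ, hsup⟩
  obtain ⟨β₀, hβ₀⟩ := exists_frame_not_clauseIIukp_typChainDeep_of_wire r.ρ hW
  obtain ⟨T, B, β₂, hβ₂⟩ := hsup (1 / 2) (by norm_num)
  obtain ⟨β₂', hβ₂'⟩ := clauses_typChainDeep_extentOf (G := G) r hθ hκ C D (1 / 2) (by norm_num) B
  obtain ⟨b, hb1, -, hbB, hframes⟩ := hβ₂ (max β₀ (max β₂ β₂')) (le_trans (le_max_left _ _) (le_max_right _ _))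
  obtain ⟨w, hw, hnot⟩ := hβ₀ (max β₀ (max β₂ β₂')) (le_max_left _ _) b hb1 (1 / 2) le_rfl
  exact hnot ((hβ₂' _ (le_trans (le_max_right _ _) (le_max_right _ _)) b hb1 hbB w hw).1 (hframes w hw).2)

end Supplier

end Summit.QuantumFields.YangMills.Cruxes.IR.AfPincerUc.SharpLanes.GroundStateForcingDeep

end
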